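import Summits.BirchSwinnertonDyer.BirchSwinnertonDyer.Theorems.AlignedTransportAtTwoMainConjectureOfRankZeroBSDAtTwoCubicChevalleyBitsNecessity
import Summits.BirchSwinnertonDyer.BirchSwinnertonDyer.Theorems.AlignedTransportAtTwoMainConjectureOfRankZeroBSDAtTwoCubicOffStratumFukudaIndex
import HarnessLib

/-!
# Route `AlignedTransportAtTwo`, crux C2 `MainConjectureOfRankZeroBSDAtTwo` (stmt-BirchSwinnertonDyer-22298):
# THE TWO CHEVALLEY BITS ARE NECESSARY, `ℚ(β)` CURRENCY — both primes of `ℚ(β)` above `2` ramify in `ℚ(β)(√2)` on every stratum, so `e₁ = 0`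
# forces `h(ℚ(β))` odd AND a non-norm unit; off the Kilford stratum `e₁ = 0 ⟺` the two displayed bits (sequel of `…ChevalleyBitsNecessity`)

HONEST FRAMING (cell `bsd-f1-sign2`, WIDTH-5 attached prover seat `bsd-line-att-p5` gen 29 on line `birth` of the lead `bsd-line-att-p2`;
`--supports` stmt-BirchSwinnertonDyer-22298, closes nothing; BSD is NOT proved by any of this; the crux C2, its verdict «blocked-on
`Rank1Residual.GreenbergMuConjectureIrreducible`» and every registered stub are untouched). THEOREMS ONLY — no definition, no named fact,
no `sorry`. The converse of att-p5 g26/g28's Chevalley door on the cubic class-group road: that door displays `h(ℚ(β))` odd and a non-norm unit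
and yields `e₀ = e₁ = 0`; here `e₁ = 0` alone gives both bits back, on EVERY stratum, because two distinct primes of `ℚ(β)` above `2` ramify in
the first layer `ℚ(β)(√2)` (the degree-one prime cut out by the canonical odd `2`-adic root — `e(w₁|2) = 1` is odd —, and a second one: of odd index
on `Δ_min ≡ 1 (mod 4)` (g27), the prime `𝔭₂` with `e = 2` on `Δ_min ≡ 3 (mod 4)` by g28's ramification transfer), so that in Chevalley's formula
`#Cl(K₁)^G · 2 · [E_K : E_K ∩ N K₁ˣ] = h_K · 2^t` (tree theorem) `t ≥ 2` makes the unit index even, while a prime of `K₁` with `e = 2 = [K₁:K]` gives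
`h_K ∣ h(K₁)` (Washington 4.11, tree).

WHAT (the generic §1–§2 live in `…ChevalleyBitsNecessity`).
* (`ℚ(β)`, good ordinary at `2`, `E_W(ℚ)[2] = 0`) **`exists_ramificationIdx_eq_one_ramificationIdxIn_ne_one_adjoin`** (the degree-one prime ramifies,
  every stratum), **`exists_ramificationIdx_eq_two_ramificationIdxIn_ne_one_adjoin`** (`Δ_min ≡ 3 (4)`: `𝔭₂` ramifies — g28's transfer read below `Q`),
  **`not_two_dvd_classNumber_and_exists_nonNorm_unit_adjoin_of_classNumberPExp_one_eq_zero`** (NECESSITY, every stratum), and the dictionary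
  **`classNumberPExp_one_eq_zero_iff_chevalleyBits_of_not_onKilfordStratumAtTwo`**: OFF the stratum `e₁(κ) = 0 ⟺ (h(ℚ(β)) odd ∧ a non-norm unit)`.

NOT here: that the non-norm unit is detected by the `2`-adic SIGN of the sibling file `…CubicChevalleyUnitSign` (true by Hasse's norm theorem and
the product formula for the quadratic extension `ℚ(β)(√2)/ℚ(β)` with its two ramified places; not kernel). Nothing is asserted about any curve's
class number; nothing is closed; BSD is not proved.

References: [Lang1990] Ch. 13 §4, Lemma 4.1 (PDF pp. 203–204); [Washington1997] Prop. 4.11, §13.1 Lemma 13.3; [Gras2003] IV.4; [NeukirchANT1999]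
Ch. I §8–§9, Ch. II §8; tree: `AmbiguousClassNumberFormula` (Chevalley), `ClassNumberDivisibilityInExtensions`, `QuadraticExtensionOddClassNumber*`,
bsd-2adic k4-w1 `…ChevalleyDoorAtTwo`, att-p5 g26 `…CubicPrimesOfEmbeddings` / `…CubicOffStratumPrimes`, g27 `…CubicOffStratumRamification`,
g28 `…CubicOffStratumFukudaIndex{,Transfer,Tools}`.
-/

set_option linter.dupNamespace false
set_option autoImplicit false

noncomputable section

open scoped Classical NumberField nonZeroDivisors

namespace Summit.BirchSwinnertonDyer.BirchSwinnertonDyer.Theorems.AlignedTransportAtTwoCubicChevalleyBitsNecessityAdjoin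

open NumberField IsDedekindDomain Polynomial
  Literature.NumberTheory.NumberFields Literature.NumberTheory.NumberFields.AmbiguousClass
  Literature.NumberTheory.NumberFields.AmbiguousIdeal Literature.NumberTheory.GaloisRepresentations
  Literature.NumberTheory.GaloisRepresentations.Herbrand Literature.NumberTheory.GaloisRepresentations.MinkowskiUnit
  Literature.NumberTheory.GaloisRepresentations.CyclicNormIndex Literature.NumberTheory.IwasawaTheory
  Literature.NumberTheory.EllipticCurves
  Summit.BirchSwinnertonDyer.BirchSwinnertonDyer.Theorems.AddKatoTwo
  Summit.BirchSwinnertonDyer.BirchSwinnertonDyer.Theorems.AlignedTransportAtTwoCubicChevalleyBitsNecessity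

/-! ## The cubic `2`-torsion field `ℚ(β)`: both primes above `2` ramify in `ℚ(β)(√2)`, so `e₁ = 0` forces the two Chevalley bits -/

section Adjoin

open WeierstrassCurve IntermediateField Field
  Literature.NumberTheory.EllipticCurves.Greenberg1999 Literature.NumberTheory.EllipticCurves.DokchitserDokchitser2012
  Summit.BirchSwinnertonDyer.Rank1Residual.F1Sign2
  Summit.BirchSwinnertonDyer.BirchSwinnertonDyer.Theorems.AlignedTransportAtTwoBridge
  Summit.BirchSwinnertonDyer.BirchSwinnertonDyer.Theorems.AlignedTransportAtTwoKilfordStratumShared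
  Summit.BirchSwinnertonDyer.BirchSwinnertonDyer.Theorems.AlignedTransportAtTwoKilfordStratum
  Summit.BirchSwinnertonDyer.BirchSwinnertonDyer.Theorems.AlignedTransportAtTwoFineRoad.DivisionCubic
  Summit.BirchSwinnertonDyer.BirchSwinnertonDyer.Theorems.AlignedTransportAtTwoFineRoad.TowerImageDelta
  Summit.BirchSwinnertonDyer.BirchSwinnertonDyer.Theorems.AlignedTransportAtTwoFineRoad.RealKummerLinesPadicLetterOnPointsPrimes
  Summit.BirchSwinnertonDyer.BirchSwinnertonDyer.Theorems.AlignedTransportAtTwoCubicKilfordPrimes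
  Summit.BirchSwinnertonDyer.BirchSwinnertonDyer.Theorems.AlignedTransportAtTwoCubicPrimesOfEmbeddings
  Summit.BirchSwinnertonDyer.BirchSwinnertonDyer.Theorems.AlignedTransportAtTwoCubicClosureParity
  Summit.BirchSwinnertonDyer.BirchSwinnertonDyer.Theorems.AlignedTransportAtTwoCubicOffStratumRamification
  Summit.BirchSwinnertonDyer.BirchSwinnertonDyer.Theorems.AlignedTransportAtTwoCubicOffStratumDedekindTable
  Summit.BirchSwinnertonDyer.BirchSwinnertonDyer.Theorems.AlignedTransportAtTwoCubicOffStratumPrimes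
  Summit.BirchSwinnertonDyer.BirchSwinnertonDyer.Theorems.AlignedTransportAtTwoCubicOffStratumFukudaIndexTools
  Summit.BirchSwinnertonDyer.BirchSwinnertonDyer.Theorems.AlignedTransportAtTwoCubicOffStratumFukudaIndexTransfer
  Summit.BirchSwinnertonDyer.BirchSwinnertonDyer.Theorems.AlignedTransportAtTwoCubicOffStratumFukudaIndex

variable (W : WeierstrassCurve ℚ) [W.IsElliptic] [W.IsGloballyMinimal]

/-- **The degree-one prime of `ℚ(β)` (cut out by the canonical odd `2`-adic root of `c_W`) ramifies in `ℚ(β)(√2)`**: `e(w₁|2) = 1` is odd.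
Good ordinary at `2`, `E_W(ℚ)[2] = 0`; every stratum. [cite: NeukirchANT1999, Ch. II §8 (8.1)–(8.3)] [cite: Washington1997, §13.1] -/
theorem exists_ramificationIdx_eq_one_ramificationIdxIn_ne_one_adjoin (hord : IsOrdinaryAt W 2) (ht : ∀ x : ℚ, ¬ HasRationalTwoTorsionX W x)
    {β : AlgebraicClosure ℚ} (hβ : aeval β W.twoTorsionPolynomial.toPoly = 0)
    (κP : ZpExtension ℚ⟮β⟯ 2) (hκP : κP.IsCyclotomic) :
    ∃ w₁ : HeightOneSpectrum (𝓞 ℚ⟮β⟯), ((2 : ℕ) : 𝓞 ℚ⟮β⟯) ∈ w₁.asIdeal ∧ w₁.asIdeal.ramificationIdx ℤ = 1 ∧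
      w₁.asIdeal.ramificationIdxIn (𝓞 (κP.layer 1)) ≠ 1 := by
  have hirr := AlignedTransportAtTwoSeed.irr_two_of_forall_not_hasRationalTwoTorsionX W ht
  have hβint : IsIntegral ℚ β := ((AlgebraicClosure.isAlgebraic ℚ).isAlgebraic β).isIntegral
  haveI : FiniteDimensional ℚ ℚ⟮β⟯ := IntermediateField.adjoin.finiteDimensional hβint
  haveI : NumberField ℚ⟮β⟯ := NumberField.mk
  have hF3 : Module.finrank ℚ ℚ⟮β⟯ = 3 := AddKatoTwo.finrank_adjoin_root_twoTorsionPolynomial_eq_three W hirr hβ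
  have hK2 : ¬ 2 ∣ Module.finrank ℚ ℚ⟮β⟯ := by rw [hF3]; norm_num
  have he₁ := aeval_four_mul_gen_twoDivisionUCubic W hβ
  -- the canonical root and its embedding
  obtain ⟨y, -, hy⟩ := exists_padicInt_root_of_isOrdinaryAt_two W hord
  have hmin : minpoly ℚ (4 * (AdjoinSimple.gen ℚ β : ℚ⟮β⟯)) = twoDivisionUCubic W := minpoly_eq_twoDivisionUCubic W ht he₁
  obtain ⟨pb, hgen, -⟩ := exists_powerBasis_gen_eq (natDegree_twoDivisionUCubic W) hF3 hmin
  have hroot : aeval (y : ℚ_[2]) (minpoly ℚ pb.gen) = 0 := by rw [hgen, hmin]; exact hy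
  set σ : ℚ⟮β⟯ →ₐ[ℚ] ℚ_[2] := pb.lift (y : ℚ_[2]) hroot with hσ
  obtain ⟨v₁, hv₁2, hv₁⟩ := exists_heightOneSpectrum_of_ringHom_padic (σ : ℚ⟮β⟯ →+* ℚ_[2])
  have hv₁' : ∀ r : 𝓞 ℚ⟮β⟯, r ∈ v₁.asIdeal ↔ ‖(σ : ℚ⟮β⟯ →+* ℚ_[2]) (algebraMap (𝓞 ℚ⟮β⟯) ℚ⟮β⟯ r)‖ < 1 :=
    mem_iff_norm_lt_one_of_valuation_iff (σ : ℚ⟮β⟯ →+* ℚ_[2]) v₁ hv₁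
  have he : v₁.asIdeal.ramificationIdx ℤ = 1 := ramificationIdx_eq_one_of_ringHom_padic (σ : ℚ⟮β⟯ →+* ℚ_[2]) v₁ hv₁'
  have hv₁2' : ((2 : ℕ) : 𝓞 ℚ⟮β⟯) ∈ v₁.asIdeal := by exact_mod_cast hv₁2
  exact ⟨v₁, hv₁2', he, ramificationIdxIn_layer_one_ne_one_of_odd_ramificationIdx hK2 κP hκP hv₁2' (by rw [he]; exact odd_one)⟩

set_option maxHeartbeats 1000000 in
set_option synthInstance.maxHeartbeats 200000 in
/-- **On `Δ_min ≡ 3 (mod 4)` the prime `𝔭₂` of `ℚ(β)` with `e(𝔭₂|2) = 2` ramifies in `ℚ(β)(√2)`, in Chevalley's currency.** Good ordinary at `2`,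
`E_W(ℚ)[2] = 0`, `Δ_min ≡ 3 (mod 4)`, `κ` a cyclotomic `ℤ₂`-extension of `ℚ(β)`: there is a prime `w₂ ∋ 2` of `ℚ(β)` with `e(w₂|2) = 2` and
`e(w₂, ℚ(β)₁) ≠ 1` — att-p5 g28's ramification transfer (a copy `T ≅ ℚ(W[2]) ∋ √Δ_min` over `ℚ(β)`, `√2 ∈ ℚ(β)₁`, a prime `Q` of `ℚ(β)₁` with
`4 ∣ e(Q|2)`, hence `e(Q ∩ ℚ(β)|2) = e(Q|Q ∩ ℚ(β)) = 2`), re-read as a statement about the prime BELOW `Q`.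
[cite: NeukirchANT1999, Ch. I §8 Prop. (8.2), §9 Prop. (9.6); Ch. II §8] [cite: Washington1997, §13.1 Lemma 13.3] -/
theorem exists_ramificationIdx_eq_two_ramificationIdxIn_ne_one_adjoin (hord : IsOrdinaryAt W 2)
    (ht : ∀ x : ℚ, ¬ HasRationalTwoTorsionX W x) (h4 : minimalDiscriminantInt W % 4 = 3)
    {β : AlgebraicClosure ℚ} (hβ : aeval β W.twoTorsionPolynomial.toPoly = 0)
    (κP : ZpExtension ℚ⟮β⟯ 2) (hκP : κP.IsCyclotomic) :
    ∃ w₂ : HeightOneSpectrum (𝓞 ℚ⟮β⟯), ((2 : ℕ) : 𝓞 ℚ⟮β⟯) ∈ w₂.asIdeal ∧ w₂.asIdeal.ramificationIdx ℤ = 2 ∧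
      w₂.asIdeal.ramificationIdxIn (𝓞 (κP.layer 1)) ≠ 1 := by
  have h2 : (2 : ℚ) ≠ 0 := two_ne_zero
  haveI : NumberField ↥(W.divisionField 2) := NumberField.mk
  haveI : IsGalois ℚ (W.divisionField 2) := W.isGalois_divisionField 2
  have hirr := AlignedTransportAtTwoSeed.irr_two_of_forall_not_hasRationalTwoTorsionX W ht
  have hβint : IsIntegral ℚ β := ((AlgebraicClosure.isAlgebraic ℚ).isAlgebraic β).isIntegral
  haveI : FiniteDimensional ℚ ℚ⟮β⟯ := IntermediateField.adjoin.finiteDimensional hβint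
  haveI : NumberField ℚ⟮β⟯ := NumberField.mk
  have hF3 : Module.finrank ℚ ℚ⟮β⟯ = 3 := AddKatoTwo.finrank_adjoin_root_twoTorsionPolynomial_eq_three W hirr hβ
  -- `T = ℚ(W[2]) ⊇ ℚ(β)` inside `ℚ̄`, with `δ = 4δ₀`, `δ² = Δ_min`
  have hβroot : β ∈ W.twoTorsionPolynomial.toPoly.rootSet (AlgebraicClosure ℚ) :=
    (mem_rootSet_of_ne (twoTorsionPolynomial_toPoly_ne_zero W h2)).mpr hβ
  have hβT : β ∈ W.divisionField 2 := rootSet_subset_divisionField W h2 hβroot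
  have hF : ℚ⟮β⟯ ≤ W.divisionField 2 := adjoin_simple_le_iff.mpr hβT
  letI algF : Algebra ℚ⟮β⟯ (W.divisionField 2) := (IntermediateField.inclusion hF).toRingHom.toAlgebra
  haveI : IsScalarTower ℚ ℚ⟮β⟯ (W.divisionField 2) :=
    IsScalarTower.of_algebraMap_eq fun q ↦ ((IntermediateField.inclusion hF).commutes q).symm
  haveI : FiniteDimensional ℚ⟮β⟯ (W.divisionField 2) := Module.Finite.of_restrictScalars_finite ℚ _ _
  haveI : IsGalois ℚ⟮β⟯ (W.divisionField 2) := IsGalois.tower_top_of_isGalois ℚ ℚ⟮β⟯ (W.divisionField 2)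
  obtain ⟨δ, hδdef⟩ : ∃ δ : AlgebraicClosure ℚ, δ = 4 * delta W h2 := ⟨_, rfl⟩
  have hδsq : δ ^ 2 = ((W.Δ : ℚ) : AlgebraicClosure ℚ) := by rw [hδdef]; exact four_mul_delta_sq W
  have hδT : δ ∈ W.divisionField 2 := by
    rw [hδdef]
    have hd : delta W h2 ∈ W.divisionField 2 := by
      change (xT W h2 0 - xT W h2 1) * (xT W h2 0 - xT W h2 2) * (xT W h2 1 - xT W h2 2) ∈ W.divisionField 2
      exact mul_mem (mul_mem (sub_mem (xT_mem_divisionField W h2 0) (xT_mem_divisionField W h2 1))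
        (sub_mem (xT_mem_divisionField W h2 0) (xT_mem_divisionField W h2 2)))
        (sub_mem (xT_mem_divisionField W h2 1) (xT_mem_divisionField W h2 2))
    exact mul_mem (ofNat_mem _ 4) hd
  have hδT' : (⟨δ, hδT⟩ : W.divisionField 2) ^ 2 = ((minimalDiscriminantInt W : ↥(W.divisionField 2))) := by
    apply Subtype.ext
    rw [SubmonoidClass.coe_pow]
    change δ ^ 2 = _
    rw [hδsq, ← cast_minimalDiscriminantInt W]
    push_cast
    rfl
  obtain ⟨T, e, -⟩ : ∃ (T : IntermediateField ℚ⟮β⟯ (AlgebraicClosure ℚ⟮β⟯))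
      (_ : ↥(W.divisionField 2) ≃ₐ[ℚ⟮β⟯] ↥T), True := by
    let ι : ↥(W.divisionField 2) →ₐ[ℚ⟮β⟯] AlgebraicClosure ℚ⟮β⟯ := IsAlgClosed.lift
    exact ⟨(⊤ : IntermediateField ℚ⟮β⟯ ↥(W.divisionField 2)).map ι,
      (IntermediateField.topEquiv.symm.trans (IntermediateField.equivMap ⊤ ι)), trivial⟩
  haveI : FiniteDimensional ℚ⟮β⟯ T := LinearEquiv.finiteDimensional e.toLinearEquiv
  haveI : IsGalois ℚ⟮β⟯ T := IsGalois.of_algEquiv e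
  haveI : NumberField T := NumberField.of_module_finite ℚ⟮β⟯ T
  have hδ''T : ((e ⟨δ, hδT⟩ : T) : AlgebraicClosure ℚ⟮β⟯) ∈ T := (e ⟨δ, hδT⟩).2
  have hδ''sq : ((e ⟨δ, hδT⟩ : T) : AlgebraicClosure ℚ⟮β⟯) ^ 2 = ((minimalDiscriminantInt W : AlgebraicClosure ℚ⟮β⟯)) := by
    have h1 : (e ⟨δ, hδT⟩ : T) ^ 2 = ((minimalDiscriminantInt W : T)) := by rw [← map_pow, hδT', map_intCast]
    have h2 := congrArg (fun z : T => (z : AlgebraicClosure ℚ⟮β⟯)) h1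
    simpa using h2
  have hT0 : ∀ P : Ideal (𝓞 ↥(W.divisionField 2)), P.IsPrime → (2 : 𝓞 ↥(W.divisionField 2)) ∈ P →
      P.ramificationIdx ℤ ≤ 2 := by
    intro P hP h2P
    exact (ramificationIdx_divisionField_two_eq_two_of_minimalDiscriminantInt_emod_four_eq_three W hord ht h4 P h2P).le
  have hT : ∀ P : Ideal (𝓞 T), P.IsPrime → (2 : 𝓞 T) ∈ P → P.ramificationIdx ℤ ≤ 2 :=
    forall_ramificationIdx_le_of_ringEquiv (RingOfIntegers.mapRingEquiv e.symm.toRingEquiv) hT0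
  -- the first layer `L = κ.layer 1 ∋ √2`
  have hK2 : ¬ 2 ∣ Module.finrank ℚ ℚ⟮β⟯ := by rw [hF3]; norm_num
  haveI : FiniteDimensional ℚ⟮β⟯ (κP.layer 1) := κP.finiteDimensional_layer_holds 1
  haveI : IsGalois ℚ⟮β⟯ (κP.layer 1) := κP.isGalois_layer_holds 1
  haveI : NumberField (κP.layer 1) := NumberField.of_module_finite ℚ⟮β⟯ _
  obtain ⟨θ, hθ⟩ := exists_sq_eq_two_layer_one_of_not_dvd_finrank hK2 κP hκP
  have hθ' : ((θ : AlgebraicClosure ℚ⟮β⟯)) ^ 2 = 2 := by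
    have := congrArg (fun z : κP.layer 1 => (z : AlgebraicClosure ℚ⟮β⟯)) hθ
    simp only [SubmonoidClass.coe_pow] at this
    rw [this]; rfl
  -- the prime `𝔭₂` of `ℚ(β)` with `e = 2`, and the transfer
  obtain ⟨w, hw2, hwe, -⟩ := exists_ramificationIdx_eq_two_adjoin_of_minimalDiscriminantInt_emod_four_eq_three W hord ht h4 hβ
  haveI : w.asIdeal.IsPrime := w.isPrime
  have hw2' : (2 : 𝓞 ℚ⟮β⟯) ∈ w.asIdeal := by exact_mod_cast hw2
  obtain ⟨Q, hQ, h2Q, h4Q⟩ := exists_four_dvd_ramificationIdx_of_sq_eq_two_of_sq_eq_intCast (κP.layer 1) T θ.2 hδ''T hθ'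
    hδ''sq h4 w.asIdeal hw2' hwe hT
  -- read below `Q`
  haveI := hQ
  obtain ⟨hunder, hQw⟩ := ramificationIdx_eq_two_of_four_dvd hF3 κP Q h2Q h4Q
  have hQ0 : Q ≠ ⊥ := fun h => by rw [h] at h2Q; exact two_ne_zero ((Ideal.mem_bot).mp h2Q)
  have hu0 : Q.under (𝓞 ℚ⟮β⟯) ≠ ⊥ := mt Ideal.eq_bot_of_comap_eq_bot hQ0
  set w₂ : HeightOneSpectrum (𝓞 ℚ⟮β⟯) := ⟨Q.under (𝓞 ℚ⟮β⟯), Ideal.IsPrime.under _ Q, hu0⟩ with hw₂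
  haveI : Q.LiesOver w₂.asIdeal := ⟨rfl⟩
  refine ⟨w₂, ?_, hunder, ?_⟩
  · change ((2 : ℕ) : 𝓞 ℚ⟮β⟯) ∈ Q.under (𝓞 ℚ⟮β⟯)
    rw [Ideal.under_def, Ideal.mem_comap, map_natCast]; exact_mod_cast h2Q
  · rw [Ideal.ramificationIdxIn_eq_ramificationIdx w₂.asIdeal Q (κP.layer 1 ≃ₐ[ℚ⟮β⟯] κP.layer 1), hQw]; norm_num

/-- **NECESSITY OF THE CHEVALLEY BITS ON THE CUBIC ROAD.** `W/ℚ` globally minimal, good ordinary at `2`, no rational `2`-torsion abscissa, `β` a root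
of the `2`-division cubic, `κ` ANY cyclotomic `ℤ₂`-extension of `ℚ(β)` — EVERY stratum. If `e₁(κ) = 0` (the class number of the first layer
`ℚ(β)(√2)` is odd) then `h(ℚ(β))` is odd AND some unit of `𝓞 ℚ(β)` is not of the form `a² − 2b²`. Two distinct primes of `ℚ(β)` above `2` ramify in
`ℚ(β)(√2)`: on `Δ_min ≡ 1 (mod 4)` all primes above `2` have odd index (att-p5 g27) and there are at least two (g26); on `Δ_min ≡ 3 (mod 4)` the
degree-one prime and `𝔭₂` (§3). With att-p5 g28's door this makes the `(0,1)` class-number certificate on the off-stratum cell EQUIVALENT to the two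
displayed bits. [cite: Lang1990, Ch. 13 §4, Lemma 4.1] [cite: Washington1997, Prop. 4.11 and §13.1] [cite: NeukirchANT1999, Ch. II §8] -/
theorem not_two_dvd_classNumber_and_exists_nonNorm_unit_adjoin_of_classNumberPExp_one_eq_zero (hord : IsOrdinaryAt W 2)
    (ht : ∀ x : ℚ, ¬ HasRationalTwoTorsionX W x) {β : AlgebraicClosure ℚ} (hβ : aeval β W.twoTorsionPolynomial.toPoly = 0)
    (κP : ZpExtension ℚ⟮β⟯ 2) (hκP : κP.IsCyclotomic) (h1 : classNumberPExp κP 1 = 0) :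
    ¬ 2 ∣ Nat.card (ClassGroup (𝓞 ℚ⟮β⟯)) ∧
      ∃ ε : 𝓞 ℚ⟮β⟯, IsUnit ε ∧ ∀ a b : ℚ⟮β⟯, (ε : ℚ⟮β⟯) ≠ a ^ 2 - 2 * b ^ 2 := by
  have hirr := AlignedTransportAtTwoSeed.irr_two_of_forall_not_hasRationalTwoTorsionX W ht
  have hβint : IsIntegral ℚ β := ((AlgebraicClosure.isAlgebraic ℚ).isAlgebraic β).isIntegral
  haveI : FiniteDimensional ℚ ℚ⟮β⟯ := IntermediateField.adjoin.finiteDimensional hβint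
  haveI : NumberField ℚ⟮β⟯ := NumberField.mk
  have hF3 : Module.finrank ℚ ℚ⟮β⟯ = 3 := AddKatoTwo.finrank_adjoin_root_twoTorsionPolynomial_eq_three W hirr hβ
  have hK2 : ¬ 2 ∣ Module.finrank ℚ ℚ⟮β⟯ := by rw [hF3]; norm_num
  rw [Nat.card_eq_fintype_card, ← NumberField.classNumber]
  obtain ⟨w₁, hw₁2, hw₁e, hw₁r⟩ := exists_ramificationIdx_eq_one_ramificationIdxIn_ne_one_adjoin W hord ht hβ κP hκP
  by_cases h4 : minimalDiscriminantInt W % 4 = 3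
  · obtain ⟨w₂, -, hw₂e, hw₂r⟩ := exists_ramificationIdx_eq_two_ramificationIdxIn_ne_one_adjoin W hord ht h4 hβ κP hκP
    have hne : w₁ ≠ w₂ := fun h => by rw [h, hw₂e] at hw₁e; exact absurd hw₁e (by norm_num)
    exact not_two_dvd_classNumber_and_exists_nonNorm_unit_of_classNumberPExp_one_eq_zero hK2 κP hκP h1 hne hw₁r hw₂r
  · have h2 : ¬ (2 : ℤ) ∣ minimalDiscriminantInt W := by
      exact_mod_cast W.not_dvd_minimalDiscriminantInt_of_hasGoodReductionAtPrime 2 hord.1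
    have h1' : minimalDiscriminantInt W % 4 = 1 := by omega
    have hodd := (forall_odd_ramificationIdx_adjoin_iff_minimalDiscriminantInt_emod_four_eq_one W hord ht hβ).mpr h1'
    -- two distinct primes above `2`, both of odd index
    have h2le := two_le_ncard_of_isOrdinaryAt_two ℚ⟮β⟯ W hord ht hF3 (aeval_four_mul_gen_twoDivisionUCubic W hβ)
    obtain ⟨v₁, v₂, hv₁, hv₂, hne⟩ :=
      (Set.one_lt_ncard_iff (finite_setOf_two_mem (F := ℚ⟮β⟯))).mp (lt_of_lt_of_le one_lt_two h2le)
    exact not_two_dvd_classNumber_and_exists_nonNorm_unit_of_classNumberPExp_one_eq_zero hK2 κP hκP h1 hne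
      (ramificationIdxIn_layer_one_ne_one_of_odd_ramificationIdx hK2 κP hκP hv₁ (hodd v₁ hv₁))
      (ramificationIdxIn_layer_one_ne_one_of_odd_ramificationIdx hK2 κP hκP hv₂ (hodd v₂ hv₂))

/-- **THE FIRST-LAYER DICTIONARY OFF THE STRATUM.** `W/ℚ` globally minimal, good ordinary at `2`, no rational `2`-torsion abscissa, OFF the Kilford
stratum, `β` a root of the `2`-division cubic, `κ` a cyclotomic `ℤ₂`-extension of `ℚ(β)`:
`e₁(κ) = 0 ⟺ (h(ℚ(β)) odd ∧ some unit of 𝓞 ℚ(β) is not an a² − 2b²)`. (⟸ is bsd-2adic's Chevalley door with «at most two primes above `2`»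
discharged off the stratum, att-p5 g26; ⟹ is the necessity above.) So Chevalley's door is exactly the case `e₀ = e₁ = 0` of the `(0,1)` class-number
certificate, and it loses nothing there. [cite: Lang1990, Ch. 13 §4, Lemma 4.1] [cite: Washington1997, Prop. 4.11 and §13.1] -/
theorem classNumberPExp_one_eq_zero_iff_chevalleyBits_of_not_onKilfordStratumAtTwo (hord : IsOrdinaryAt W 2)
    (ht : ∀ x : ℚ, ¬ HasRationalTwoTorsionX W x) (hs : ¬ OnKilfordStratumAtTwo W)
    {β : AlgebraicClosure ℚ} (hβ : aeval β W.twoTorsionPolynomial.toPoly = 0)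
    (κP : ZpExtension ℚ⟮β⟯ 2) (hκP : κP.IsCyclotomic) :
    classNumberPExp κP 1 = 0 ↔
      (¬ 2 ∣ Nat.card (ClassGroup (𝓞 ℚ⟮β⟯)) ∧
        ∃ ε : 𝓞 ℚ⟮β⟯, IsUnit ε ∧ ∀ a b : ℚ⟮β⟯, (ε : ℚ⟮β⟯) ≠ a ^ 2 - 2 * b ^ 2) := by
  refine ⟨not_two_dvd_classNumber_and_exists_nonNorm_unit_adjoin_of_classNumberPExp_one_eq_zero W hord ht hβ κP hκP, ?_⟩
  rintro ⟨hh, ε, hεu, hnn⟩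
  have hirr := AlignedTransportAtTwoSeed.irr_two_of_forall_not_hasRationalTwoTorsionX W ht
  have hβint : IsIntegral ℚ β := ((AlgebraicClosure.isAlgebraic ℚ).isAlgebraic β).isIntegral
  haveI : FiniteDimensional ℚ ℚ⟮β⟯ := IntermediateField.adjoin.finiteDimensional hβint
  haveI : NumberField ℚ⟮β⟯ := NumberField.mk
  have hF3 : Module.finrank ℚ ℚ⟮β⟯ = 3 := AddKatoTwo.finrank_adjoin_root_twoTorsionPolynomial_eq_three W hirr hβ
  have hK2 : ¬ 2 ∣ Module.finrank ℚ ℚ⟮β⟯ := by rw [hF3]; norm_num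
  have hh' : ¬ 2 ∣ classNumber ℚ⟮β⟯ := by rwa [NumberField.classNumber, ← Nat.card_eq_fintype_card]
  exact AddKatoTwo.classNumberPExp_one_eq_zero_of_nonNorm_unit_two hK2 κP hκP hh'
    (ncard_adjoin_le_two_of_not_onKilfordStratumAtTwo W ht hs hβ) hεu hnn

end Adjoin

end Summit.BirchSwinnertonDyer.BirchSwinnertonDyer.Theorems.AlignedTransportAtTwoCubicChevalleyBitsNecessityAdjoin

end
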